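import Summits.ResolutionOfSingularities.ResolutionOfSingularities.Theorems.FrobeniusLadderFInjectiveMacaulayficationFullLastCentreSlack
import Summits.ResolutionOfSingularities.ResolutionOfSingularities.Theorems.FrobeniusLadderFInjectiveMacaulayficationFullLastCentreDefs2
import HarnessLib

/-!
# K10h — TAMENESS IS A ONE-STAGE CONSEQUENCE OF NON-POSITIVE SLACKS AND THE DROP-POINT BUDGET: `AllSlackLE S α → DropBudget S → ord₀ N ≤ 8`
# (crux `FInjectiveMacaulayfication` stmt-ResolutionOfSingularities-15315, chain w45a; the slack identity `ρ = ω − |α| ≤ 8 + Σ τ_n` of `T-disc` §0.5♯ in the typed layer; the chain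
# theorems K10e/K10f/K10g only PROPAGATE non-positive slacks — this file isolates the one-stage step; seat res-L1-w45a-lead-1 g16)

[OURS · L1 W4.5a] Support file (`--supports stmt-ResolutionOfSingularities-15315 --as helper`); theorems only; replaces the role of NO printed item; NOT a statement of any
manuscript; proves nothing of the crux; OURS counted 0. AI-written (AI review is weaker than expert review).
* `exists_residual_le_of_budget`: if `D = y^α·N` and some monomial of `D` has degree `≤ B`, then some monomial `e` of `N` has `tdeg e + tdeg α ≤ B` (`ω = |α| + ρ`).
* ★ `ordLE_eight_of_allSlackLE_dropBudget`: at ANY stage, non-positive slacks (`2d_n ≤ α_n` on `Exc`) and the drop-point budget (`ω ≤ 8 + 2Σ_{Exc} d_n`) give `ρ ≤ 8`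
  — no chain, no chart, no canonicity. Consequently every cap theorem reduces to «the history keeps the slacks non-positive (or ρ ≤ 8 already)», and the only way to
  exceed 8 at a budgeted point is POSITIVE SLACK on some exceptional letter through it, i.e. an earlier LOW-ORDER centre (`ν_Z < 2(codim Z − 1)`, K10f).
* `allSlackLE_mono`: non-positive slacks persist when exceptional letters are forgotten (sub-configuration through a nearby point with the same `α`, `d` on the
  surviving letters) — the bookkeeping half of the fibre-point gap (g2); the translation step itself is not typed here.
-/

-- single-problem summit: the doubled namespace component is forced
set_option linter.dupNamespace false

noncomputable section

open MvPolynomial Finsupp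
open Summit.ResolutionOfSingularities.ResolutionOfSingularities.Theorems.FInjectiveMacaulayfication.LastCentreDefs
open Summit.ResolutionOfSingularities.ResolutionOfSingularities.Theorems.FInjectiveMacaulayfication.LastCentreAxisOrder
open Summit.ResolutionOfSingularities.ResolutionOfSingularities.Theorems.FInjectiveMacaulayfication.LastCentreSlack

namespace Summit.ResolutionOfSingularities.ResolutionOfSingularities.Theorems.FInjectiveMacaulayfication.LastCentreTame

variable {k : Type} [Field k]

/-- `ω = |α| + ρ`, budget form: a monomial of `D = y^α·N` of degree `≤ B` gives a monomial `e` of `N` with `tdeg e + tdeg α ≤ B`. [OURS · L1 W4.5a] -/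
theorem exists_residual_le_of_budget {Exc : Finset Letter} {D : YPoly k} {α : Expo} {N : YPoly k} (h : IsResidual Exc D α N)
    {B : ℤ} (hbud : ∃ f ∈ D.support, (tdeg f : ℤ) ≤ B) : ∃ e ∈ N.support, (tdeg e : ℤ) + tdeg α ≤ B := by
  obtain ⟨f, hf, hfb⟩ := hbud
  have hc : coeff f (monomial α (1 : k) * N) ≠ 0 := by rw [← h.1]; exact MvPolynomial.mem_support_iff.mp hf
  obtain ⟨hle, hc2⟩ := le_and_coeff_of_coeff_monomial_mul hc
  refine ⟨f - α, MvPolynomial.mem_support_iff.mpr hc2, ?_⟩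
  have h1 : tdeg (f - α) + tdeg α = tdeg f := by rw [tdeg_tsub hle]; have := tdeg_mono hle; omega
  have : ((tdeg (f - α) : ℕ) : ℤ) + tdeg α = tdeg f := by exact_mod_cast h1
  linarith

/-- ★ TAMENESS IS ONE-STAGE: non-positive slacks and the drop-point budget give `ord₀ N ≤ 8` (`ρ = ω − |α| ≤ 8 + 2Σd − Σα ≤ 8`). [OURS · L1 W4.5a] -/
theorem ordLE_eight_of_allSlackLE_dropBudget {S : Stage k} {α : Expo} {N : YPoly k} (hres : IsResidual S.Exc S.D α N)
    (hslack : AllSlackLE S α) (hbud : DropBudget S) : OrdLE N 8 := by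
  classical
  obtain ⟨e, he, hb⟩ := exists_residual_le_of_budget hres hbud
  refine ⟨e, he, ?_⟩
  -- 2Σ_{Exc} d ≤ Σ_{Exc} α ≤ |α|
  have h1 : 2 * ∑ n ∈ S.Exc, S.d n ≤ ∑ n ∈ S.Exc, (α n : ℤ) := by
    rw [Finset.mul_sum]; exact Finset.sum_le_sum fun n hn => hslack n hn
  have h2 : (∑ n ∈ S.Exc, (α n : ℤ)) ≤ (tdeg α : ℤ) := by
    rw [tdeg, Nat.cast_sum]
    exact Finset.sum_le_sum_of_subset_of_nonneg (Finset.subset_univ _) fun n _ _ => by positivity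
  have : (tdeg e : ℤ) ≤ 8 := by linarith
  exact_mod_cast this

/-- Forgetting exceptional letters (a nearby point through which only the letters of `Exc′ ⊆ Exc` pass, with the same defects and exponents on them) keeps the slacks
non-positive. [OURS · L1 W4.5a · bookkeeping for the fibre-point gap] -/
theorem allSlackLE_mono {S S' : Stage k} {α α' : Expo} (hExc : S'.Exc ⊆ S.Exc) (hd : ∀ n ∈ S'.Exc, S'.d n = S.d n)
    (hα : ∀ n ∈ S'.Exc, α' n = α n) (h : AllSlackLE S α) : AllSlackLE S' α' := by
  intro n hn
  rw [hd n hn, hα n hn]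
  exact h n (hExc hn)

end Summit.ResolutionOfSingularities.ResolutionOfSingularities.Theorems.FInjectiveMacaulayfication.LastCentreTame

end
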